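import Summits.ABC.IUTFork.Thm311RealInd1StripPacketCeiling
import Literature.IUT.LogVolume.TensorPacketTraceZeroDyadicSqrtNegOne
import HarnessLib

/-!
# [IUTchIII] Thm 3.11 (i) (Ind1)+(Ind2) on a TENSOR PACKET all of whose factors are `≅ ℚ₂(√−1)`: the packet hull washout of
# `Thm311RealInd1StripPacketHullWashout` FAILS — the trace-zero part of `log₂(R_I^×)` has STRICTLY SMALLER hull than the container, and print's
# factorwise group never lifts a deep packet region into the container's top polyshell (UNCONDITIONAL; `p = 2` VOLUME side, packet level)

PROOF-ONLY file (abc-iut cell, Cor. 3.12 sub-crew, seat abc-iut-c312-1 = holder of record of the typed [IUTchIII] Thm. 3.11, gen 24; row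
«C:P2-PACKET-HULL-GAP», file 3/3, over `Thm311RealInd1StripPacketCeiling` (R20 file 2: the packet CEILING `M + c·(log_p(R_I^×) ∩ Ker Tr_X)` of
print's factorwise (Ind1)⊔(Ind2) group, `p`-GENERIC) and the classical `Literature.IUT.LogVolume.TensorPacketTraceZeroDyadicSqrtNegOne`).
TAKES NO SIDE on [IUTchIII] Cor. 3.12.  No definition, no `Prop` fact, no instance, no notation; no Jannsen–Wingberg / Diekert–Nishio binder.

WHY.  R20 (`packetHull_smul_inter_ker_trace_eq`, p5xxxxx): if ONE factor of the packet is tame of degree `≥ 2`, the trace-zero part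
`c·(log_p(R_I^×) ∩ Ker Tr_V)` already has the container's `(R_I)^∼`-hull, so the ceiling of print's factorwise group saves nothing at the hull
level.  At `p = 2` no factor is tame.  For the dyadic shape where `log₂(𝒪^×)` is a ball — every factor `K_b ∋ √−1` with `(e, f) = (2, 1)`, i.e.
`K_b ≅ ℚ₂(√−1)` (for a number field containing `√−1`: all its dyadic places of local degree `2`) — file 2/3 proves that trace-zero elements of
`log₂(R_I^×)` are ONE SHELL SHORT in every component of any decomposition `ψ : V ≃ₐ Π_j L_j`.  THIS FILE draws the hull consequences:

* §1 radii: `norm_psi_le_of_mem_smul_logPacket` (container: `‖ψ(x)_j‖ ≤ ‖c‖·ρ^{3n}`, attained at `c·⊗_b ϖ_b³`), **`norm_psi_le_of_mem_smul_logPacket_inter_ker`**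
  (ceiling part: `‖ψ(x)_j‖ ≤ ‖c‖·ρ^{3n+1}`), `hullRadius_smul_logPacket_inter_ker_lt` (`c ≠ 0`: hull radius of the ceiling part `<` the
  container's, in EVERY component);
* §2 hulls: **`packetHull_smul_logPacket_inter_ker_trace_ne`** — for `c ≠ 0`, `packetHull(c·log₂(R_I^×) ∩ Ker Tr_V) ≠ packetHull(c·log₂(R_I^×))`:
  THE PACKET WASHOUT FAILS at every all-`ℚ₂(√−1)` packet, every factor count; **`packetHull_union_subset_preimage_polydisc_of_deep`** /
  `smul_purePacket_not_mem_packetHull_union_of_deep` — for a DEEP region `M` (all components `≤ ‖c‖·ρ^{3n+1}`) the hull of `M ∪ ceiling part`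
  stays in the sub-polydisc of radius `‖c‖·ρ^{3n+1}` and misses `c·⊗_b ϖ_b³`: it is NOT the container's hull (contrast R20
  `packetHull_union_smul_inter_ker_trace_eq`: with one tame factor it IS, for every region); and the displayed equivalence
  **`packetHull_eq_packetHull_smul_logPacket_iff`** — for ANY `S` with `M ⊆ S ⊆ M + ceiling part` (e.g. print's orbit span of `M`):
  `packetHull(S) = packetHull(container)` ⟺ `M` ITSELF reaches the top polyshell in every component;
* §3 print's group at a GENUINE all-`ℚ₂(√−1)` packet of places `w_b ∣ 2` of a number field (R20 file 2's factorwise elements `g`, acting on pure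
  tensors through `γ_b ∈ ⟨Real.ind1Strip ∪ Real.ismIsm⟩`): **`norm_psi_apply_le_of_factorwise_printInd1Ind2_of_deep`** — for a `ℤ₂`-stable deep
  region `M ⊆ c·log₂(R_I^×)` and `x ∈ M`, every component of `ψ(g x)` is `≤ ‖c‖·ρ^{3n+1} < ‖c‖·ρ^{3n}`: print's factorwise (Ind1)⊔(Ind2) AS TYPED
  never lifts a deep packet region into the container's top polyshell — whereas Dupuy–Hilado's `indTwo` generates all of `c·log₂(R_I^×)` from any
  region of content `c` (`TensorPacketOrbitSpan`).
READING (numbers about OUR typed objects, ONE dyadic prime packet shape): at an all-`ℚ₂(√−1)` packet the lineage's packet ceiling — the only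
route by which print's factorwise indeterminacies AS TYPED enlarge a region's hull — is confined one shell below the container's top in every
component, so the per-image / union Θ-side hulls computed over print's (Ind1)⊔(Ind2) can coincide with the container's only for regions that
ALREADY reach the top polyshell; the `p = 2` summand of R32's localisation is thereby NOT washed out the way every tame odd prime's is.
HONEST SCOPE: packets all of whose factors have shape `(e, f) = (2, 1)` with `√−1` (mixed dyadic packets NOT treated); OUR typing of print's
(Ind1)/(Ind2) (THE equivariant lift, THE logarithm, factorwise action as in p516014's `hg`; F-B28-1 untouched); nothing here computes `ln ν̄_{𝕃_2}`,
a log-volume, or which regions a Θ-pilot presents; no side taken on [IUTchIII] Cor. 3.12 / [IUTchIV] Thm. 1.10 or on any author; NO abc claim.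
[claim: Mochizuki2012, status: disputed]; [cite: Mochizuki2012, IUTchIII Rmk. 3.9.5 (i) p. 127; Thm. 3.11 (i) (Ind1)(Ind2) p. 154; Cor. 3.12 Step
(xi) p. 183; IUTchIV Prop. 1.2 (i) p. 10, Prop. 1.4 (i) p. 13]; [cite: DupuyHilado2025, §4.9, §4.12]; [cite: NeukirchANT1999, Ch. II Prop. (5.5),
(5.7)]. typed ≠ proved; located ≠ adjudicated.
-/

set_option autoImplicit false

noncomputable section

open Metric Set Bornology
open scoped Pointwise TensorProduct

namespace Summit.ABC.IUTFork.Thm311.Real.PacketHull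

open Literature.IUT.LogVolume Literature.IUT.LogVolume.TraceZeroDyadicSqrtNegOne
open Literature.NumberTheory.GaloisRepresentations.Ultrametric

section Abstract

variable {I : Type} [Fintype I] [DecidableEq I]
variable (k : I → Type) [∀ b, NontriviallyNormedField (k b)] [∀ b, NormedAlgebra ℚ_[2] (k b)]
  [∀ b, IsUltrametricDist (k b)] [∀ b, ProperSpace (k b)]
variable {J : Type} [Fintype J] (L : J → Type) [∀ j, NontriviallyNormedField (L j)] [∀ j, NormedAlgebra ℚ_[2] (L j)]
  [∀ j, IsUltrametricDist (L j)] [∀ j, ProperSpace (L j)]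
variable (ψ : PacketAlgebra 2 k ≃ₐ[ℚ_[2]] (Π j, L j))
variable {ι : Π b, k b} (hι : ∀ b, ι b ^ 2 = -1) (he : ∀ b, absRamificationIdx 2 (k b) = 2) (hf : ∀ b, residueDegree 2 (k b) = 1)
  {ϖ : Π b, (k b)ˣ} (hϖ : ∀ b, IsUniformizer (ϖ b))

include hι he hf hϖ

/-! ## §1 Radii: the container reaches `‖c‖·ρ^{3n}`, its trace-zero part stays `≤ ‖c‖·ρ^{3n+1}` -/

omit [Fintype J] [∀ j, ProperSpace (L j)] in
/-- **Container radius.**  Every `x ∈ c·log₂(R_I^×)` has `‖ψ(x)_j‖ ≤ ‖c‖·‖ϖ_{b₀}‖^{3n}` in every component, and `c·⊗_b ϖ_b³ ∈ c·log₂(R_I^×)` attains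
it (`n = #I`; all `‖ϖ_b‖` agree). [cite: Mochizuki2012, IUTchIV Prop. 1.2 (i) p. 10; Prop. 1.4 (i) p. 13] [cite: DupuyHilado2025, §4.12]
[claim: Mochizuki2012, status: disputed] -/
theorem norm_psi_le_of_mem_smul_logPacket (b₀ : I) (c : ℚ_[2]) {x : PacketAlgebra 2 k}
    (hx : x ∈ c • (logPacket 2 k : Set (PacketAlgebra 2 k))) (j : J) :
    ‖ψ x j‖ ≤ ‖c‖ * ‖(ϖ b₀ : k b₀)‖ ^ (3 * Fintype.card I) ∧
      c • purePacket 2 k (fun b => (ϖ b : k b) ^ 3) ∈ c • (logPacket 2 k : Set (PacketAlgebra 2 k)) ∧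
      ‖ψ (c • purePacket 2 k (fun b => (ϖ b : k b) ^ 3)) j‖ = ‖c‖ * ‖(ϖ b₀ : k b₀)‖ ^ (3 * Fintype.card I) := by
  obtain ⟨hπL, hπn⟩ := purePacket_pow_three_mem_logPacket_and_norm k L ψ hι he hf hϖ b₀ j
  refine ⟨?_, Set.smul_mem_smul_set hπL, by rw [map_smul, Pi.smul_apply, norm_smul, hπn]⟩
  have hmax : ∀ b, ∀ w ∈ logUnits (k b), ‖w‖ ≤ ‖(ϖ b : k b) ^ 3‖ := fun b w hw => by
    have h := (isGreatest_norm_logUnits (hϖ b) (hι b) (he b) (hf b)).2 ⟨w, hw, rfl⟩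
    rw [norm_pow, ← zpow_natCast, Nat.cast_ofNat]; exact h
  have h := norm_apply_le_of_mem_smul_logPacket 2 k L ψ (fun b => (ϖ b : k b) ^ 3) hmax c hx j
  rw [← hπn, psi_purePacket_apply, norm_prod]
  simpa only [norm_factorEmb] using h

omit [Fintype J] [∀ j, ProperSpace (L j)] in
/-- **Ceiling-part radius.**  Every `x ∈ c·log₂(R_I^×) ∩ Ker Tr_V` (the trace-zero part of the container — the lineage's packet ceiling direction,
`Thm311RealInd1StripPacketCeiling`) has `‖ψ(x)_j‖ ≤ ‖c‖·‖ϖ_{b₀}‖^{3n+1}` in EVERY component: one shell below the container's top (file 2/3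
`norm_psi_le_of_mem_logPacket_of_trace_eq_zero`). [cite: Mochizuki2012, IUTchIII Thm. 3.11 (i) p. 154; IUTchIV Prop. 1.4 (i) p. 13]
[cite: NeukirchANT1999, Ch. II Prop. (5.5), (5.7)] [claim: Mochizuki2012, status: disputed] -/
theorem norm_psi_le_of_mem_smul_logPacket_inter_ker (b₀ : I) (c : ℚ_[2]) {x : PacketAlgebra 2 k}
    (hx : x ∈ c • (logPacket 2 k : Set (PacketAlgebra 2 k)) ∩ {y | Algebra.trace ℚ_[2] (PacketAlgebra 2 k) y = 0}) (j : J) :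
    ‖ψ x j‖ ≤ ‖c‖ * ‖(ϖ b₀ : k b₀)‖ ^ (3 * Fintype.card I + 1) := by
  obtain ⟨hx, hxtr⟩ := hx
  obtain ⟨y, hy, rfl⟩ := Set.mem_smul_set.mp hx
  change Algebra.trace ℚ_[2] (PacketAlgebra 2 k) (c • y) = 0 at hxtr
  rw [map_smul, Pi.smul_apply, norm_smul]
  by_cases hc : c = 0
  · rw [hc, norm_zero, zero_mul, zero_mul]
  · rw [map_smul, smul_eq_zero] at hxtr
    exact mul_le_mul_of_nonneg_left
      (norm_psi_le_of_mem_logPacket_of_trace_eq_zero k L ψ hι he hf hϖ b₀ hy (hxtr.resolve_left hc) j).1 (norm_nonneg c)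

omit hι he hf in
omit [DecidableEq I] [∀ b, IsUltrametricDist (k b)] [∀ b, ProperSpace (k b)] [∀ b, NormedAlgebra ℚ_[2] (k b)] [Fintype J]
  [∀ j, ProperSpace (L j)] [∀ j, NormedAlgebra ℚ_[2] (L j)] [∀ j, IsUltrametricDist (L j)] in
/-- `‖c‖·ρ^{3n+1} < ‖c‖·ρ^{3n}` for `c ≠ 0`. [cite: NeukirchANT1999, Ch. II Prop. (5.5)] -/
theorem norm_mul_pow_succ_lt (b₀ : I) {c : ℚ_[2]} (hc : c ≠ 0) :
    ‖c‖ * ‖(ϖ b₀ : k b₀)‖ ^ (3 * Fintype.card I + 1) < ‖c‖ * ‖(ϖ b₀ : k b₀)‖ ^ (3 * Fintype.card I) :=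
  mul_lt_mul_of_pos_left (pow_lt_pow_right_of_lt_one₀ (norm_units_pos (ϖ b₀)) (hϖ b₀).1 (by omega)) (norm_pos_iff.mpr hc)

omit [∀ j, ProperSpace (L j)] in
/-- The image of `c·log₂(R_I^×)` under `ψ` is bounded (it lies in a polydisc). [cite: Mochizuki2012, IUTchIV Prop. 1.4 (i) p. 13]
[claim: Mochizuki2012, status: disputed] -/
theorem isBounded_image_smul_logPacket (b₀ : I) (c : ℚ_[2]) :
    IsBounded (ψ '' (c • (logPacket 2 k : Set (PacketAlgebra 2 k)))) := by
  refine (isBounded_polydisc L fun _ => ‖c‖ * ‖(ϖ b₀ : k b₀)‖ ^ (3 * Fintype.card I)).subset ?_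
  rintro _ ⟨x, hx, rfl⟩
  exact (mem_polydisc L).mpr fun j => (norm_psi_le_of_mem_smul_logPacket k L ψ hι he hf hϖ b₀ c hx j).1

omit [∀ j, ProperSpace (L j)] in
/-- **In EVERY component the hull radius of the ceiling part is STRICTLY below the container's** (`c ≠ 0`). [cite: Mochizuki2012, IUTchIII
Rmk. 3.9.5 (i) p. 127] [cite: DupuyHilado2025, §4.12] [claim: Mochizuki2012, status: disputed] -/
theorem hullRadius_smul_logPacket_inter_ker_lt (b₀ : I) {c : ℚ_[2]} (hc : c ≠ 0) (j : J) :
    hullRadius L (ψ '' (c • (logPacket 2 k : Set (PacketAlgebra 2 k)) ∩ {y | Algebra.trace ℚ_[2] (PacketAlgebra 2 k) y = 0})) j <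
      hullRadius L (ψ '' (c • (logPacket 2 k : Set (PacketAlgebra 2 k)))) j := by
  have hA : hullRadius L (ψ '' (c • (logPacket 2 k : Set (PacketAlgebra 2 k)) ∩
      {y | Algebra.trace ℚ_[2] (PacketAlgebra 2 k) y = 0})) j ≤ ‖c‖ * ‖(ϖ b₀ : k b₀)‖ ^ (3 * Fintype.card I + 1) := by
    refine hullRadius_le_of_nonneg L (by positivity) ?_
    rintro _ ⟨x, hx, rfl⟩
    exact norm_psi_le_of_mem_smul_logPacket_inter_ker k L ψ hι he hf hϖ b₀ c hx j
  obtain ⟨-, hπB, hπn⟩ := norm_psi_le_of_mem_smul_logPacket k L ψ hι he hf hϖ b₀ c (x := 0)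
    (by rw [← smul_zero c]; exact Set.smul_mem_smul_set (logPacket 2 k).zero_mem) j
  have hB : ‖c‖ * ‖(ϖ b₀ : k b₀)‖ ^ (3 * Fintype.card I) ≤ hullRadius L (ψ '' (c • (logPacket 2 k : Set (PacketAlgebra 2 k)))) j := by
    rw [← hπn]
    exact norm_apply_le_hullRadius L (isBounded_image_smul_logPacket k L ψ hι he hf hϖ b₀ c) ⟨_, hπB, rfl⟩ j
  exact hA.trans_lt ((norm_mul_pow_succ_lt k hϖ b₀ hc).trans_le hB)

/-! ## §2 Hulls: the packet washout FAILS; deep regions stay one shell down -/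

/-- **THE PACKET WASHOUT FAILS AT AN ALL-`ℚ₂(√−1)` PACKET.**  For `c ≠ 0`: `packetHull(c·log₂(R_I^×) ∩ Ker Tr_V) ≠ packetHull(c·log₂(R_I^×))` —
`c·⊗_b ϖ_b³` lies in the latter and not in the former (its components have the container's top norm `‖c‖·ρ^{3n}`, above every hull radius of
the ceiling part).  Contrast R20 `packetHull_smul_inter_ker_trace_eq`: with ONE tame factor of degree `≥ 2` the two hulls are EQUAL.
[cite: Mochizuki2012, IUTchIII Rmk. 3.9.5 (i) p. 127; Thm. 3.11 (i) p. 154; Cor. 3.12 Step (xi) p. 183] [cite: DupuyHilado2025, §4.9, §4.12]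
[claim: Mochizuki2012, status: disputed] -/
theorem packetHull_smul_logPacket_inter_ker_trace_ne_of_decomp (ψ : PacketAlgebra 2 k ≃ₐ[ℚ_[2]] (Π j, L j)) (b₀ : I) {c : ℚ_[2]}
    (hc : c ≠ 0) :
    packetHull 2 k (c • (logPacket 2 k : Set (PacketAlgebra 2 k)) ∩ {y | Algebra.trace ℚ_[2] (PacketAlgebra 2 k) y = 0}) ≠
      packetHull 2 k (c • (logPacket 2 k : Set (PacketAlgebra 2 k))) := by
  classical
  haveI : Nonempty I := ⟨b₀⟩
  obtain ⟨j⟩ : Nonempty J := by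
    -- `ψ` is an equivalence onto `Π_j L_j` and `V ≠ 0`, so `J` is nonempty
    by_contra hJ
    rw [not_nonempty_iff] at hJ
    have h1 : ψ 1 = ψ 0 := Subsingleton.elim _ _
    exact one_ne_zero (ψ.injective h1)
  set A : Set (PacketAlgebra 2 k) := c • (logPacket 2 k : Set (PacketAlgebra 2 k)) ∩
    {y | Algebra.trace ℚ_[2] (PacketAlgebra 2 k) y = 0} with hA
  set B : Set (PacketAlgebra 2 k) := c • (logPacket 2 k : Set (PacketAlgebra 2 k)) with hB
  have hBbdd : IsBounded (ψ '' B) := isBounded_image_smul_logPacket k L ψ hι he hf hϖ b₀ c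
  have hAbdd : IsBounded (ψ '' A) := hBbdd.subset (Set.image_mono Set.inter_subset_left)
  obtain ⟨-, hπB, hπn⟩ := norm_psi_le_of_mem_smul_logPacket k L ψ hι he hf hϖ b₀ c (x := 0)
    (by rw [← smul_zero c]; exact Set.smul_mem_smul_set (logPacket 2 k).zero_mem) j
  intro hAB
  -- `c·π ∈ packetHull B = packetHull A = ψ⁻¹ polydisc(radii of ψ '' A)`
  have hmem : c • purePacket 2 k (fun b => (ϖ b : k b) ^ 3) ∈ packetHull 2 k A := by
    rw [hAB]; exact subset_packetHull 2 k B hπB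
  rw [packetHull_eq_preimage_holomorphicHull 2 k L ψ hAbdd, Set.mem_preimage, holomorphicHull_of_isBounded L hAbdd, mem_polydisc] at hmem
  have h1 := hmem j
  rw [hπn] at h1
  have hA' : hullRadius L (ψ '' A) j ≤ ‖c‖ * ‖(ϖ b₀ : k b₀)‖ ^ (3 * Fintype.card I + 1) := by
    refine hullRadius_le_of_nonneg L (by positivity) ?_
    rintro _ ⟨x, hx, rfl⟩
    exact norm_psi_le_of_mem_smul_logPacket_inter_ker k L ψ hι he hf hϖ b₀ c hx j
  exact absurd (h1.trans hA') (not_le.mpr (norm_mul_pow_succ_lt k hϖ b₀ hc))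

/-- **THE PACKET WASHOUT FAILS (intrinsic form)**: for `c ≠ 0`, `packetHull(c·log₂(R_I^×) ∩ Ker Tr_V) ≠ packetHull(c·log₂(R_I^×))` at every packet all
of whose factors are `≅ ℚ₂(√−1)` (read through the chosen decomposition `dEquiv`, abc-iut-S8; the hull does not depend on it).
[cite: Mochizuki2012, IUTchIII Rmk. 3.9.5 (i) p. 127; Cor. 3.12 Step (xi) p. 183] [cite: DupuyHilado2025, §4.9, §4.12] [claim: Mochizuki2012, status: disputed] -/
theorem packetHull_smul_logPacket_inter_ker_trace_ne (b₀ : I) {c : ℚ_[2]} (hc : c ≠ 0) :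
    packetHull 2 k (c • (logPacket 2 k : Set (PacketAlgebra 2 k)) ∩ {y | Algebra.trace ℚ_[2] (PacketAlgebra 2 k) y = 0}) ≠
      packetHull 2 k (c • (logPacket 2 k : Set (PacketAlgebra 2 k))) := by
  haveI : Nonempty I := ⟨b₀⟩
  exact packetHull_smul_logPacket_inter_ker_trace_ne_of_decomp k (DFac 2 k) hι he hf hϖ (dEquiv 2 k) b₀ hc

/-- **DEEP regions: the hull of `M ∪ ceiling part` stays in the sub-polydisc of radius `‖c‖·ρ^{3n+1}`.**  If every element of `M` has all
`ψ`-components of norm `≤ ‖c‖·‖ϖ‖^{3n+1}` (e.g. `M ⊆ c·ϖ_{b₁}·log₂(R_I^×)`), then `packetHull(M ∪ (c·log₂(R_I^×) ∩ Ker Tr_V)) ⊆ ψ⁻¹(polydisc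
‖c‖·ρ^{3n+1})`. [cite: Mochizuki2012, IUTchIII Rmk. 3.9.5 (i) p. 127; Cor. 3.12 Step (xi) p. 183] [cite: DupuyHilado2025, §4.12]
[claim: Mochizuki2012, status: disputed] -/
theorem packetHull_union_subset_preimage_polydisc_of_deep (b₀ : I) (c : ℚ_[2]) {M : Set (PacketAlgebra 2 k)}
    (hdeep : ∀ x ∈ M, ∀ j, ‖ψ x j‖ ≤ ‖c‖ * ‖(ϖ b₀ : k b₀)‖ ^ (3 * Fintype.card I + 1)) :
    packetHull 2 k (M ∪ c • (logPacket 2 k : Set (PacketAlgebra 2 k)) ∩ {y | Algebra.trace ℚ_[2] (PacketAlgebra 2 k) y = 0}) ⊆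
      ψ ⁻¹' polydisc L (fun _ => ‖c‖ * ‖(ϖ b₀ : k b₀)‖ ^ (3 * Fintype.card I + 1)) := by
  haveI : Nonempty I := ⟨b₀⟩
  set r : J → ℝ := fun _ => ‖c‖ * ‖(ϖ b₀ : k b₀)‖ ^ (3 * Fintype.card I + 1) with hr
  set U : Set (PacketAlgebra 2 k) := M ∪ c • (logPacket 2 k : Set (PacketAlgebra 2 k)) ∩
    {y | Algebra.trace ℚ_[2] (PacketAlgebra 2 k) y = 0} with hU
  have hUle : ∀ x ∈ U, ∀ j, ‖ψ x j‖ ≤ r j := by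
    rintro x (hx | hx) j
    · exact hdeep x hx j
    · exact norm_psi_le_of_mem_smul_logPacket_inter_ker k L ψ hι he hf hϖ b₀ c hx j
  have hUbdd : IsBounded (ψ '' U) := by
    refine (isBounded_polydisc L r).subset ?_
    rintro _ ⟨x, hx, rfl⟩
    exact (mem_polydisc L).mpr (hUle x hx)
  rw [packetHull_eq_preimage_holomorphicHull 2 k L ψ hUbdd, holomorphicHull_of_isBounded L hUbdd]
  refine Set.preimage_mono (polydisc_mono L fun j => ?_)
  exact hullRadius_le_of_nonneg L (by positivity) (by rintro _ ⟨x, hx, rfl⟩; exact hUle x hx j)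

/-- **… so it misses `c·⊗_b ϖ_b³` and is NOT the container's hull** (`c ≠ 0`, `M` deep): the packet twin of the single-place
`coe_span_add_inter_ker_ne_coe_span_smul_logUnits_of_deep` (`Thm311RealInd1StripHullDyadic`), and the failure, at an all-`ℚ₂(√−1)` packet, of R20's
`packetHull_union_smul_inter_ker_trace_eq` (which fills the container's hull from ANY region when one factor is tame of degree `≥ 2`).
[cite: Mochizuki2012, IUTchIII Rmk. 3.9.5 (i) p. 127; Cor. 3.12 Step (xi) p. 183] [cite: DupuyHilado2025, §4.9, §4.12] [claim: Mochizuki2012,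
status: disputed] -/
theorem smul_purePacket_not_mem_packetHull_union_of_deep (b₀ : I) {c : ℚ_[2]} (hc : c ≠ 0) {M : Set (PacketAlgebra 2 k)}
    (hdeep : ∀ x ∈ M, ∀ j, ‖ψ x j‖ ≤ ‖c‖ * ‖(ϖ b₀ : k b₀)‖ ^ (3 * Fintype.card I + 1)) (j : J) :
    c • purePacket 2 k (fun b => (ϖ b : k b) ^ 3) ∉
        packetHull 2 k (M ∪ c • (logPacket 2 k : Set (PacketAlgebra 2 k)) ∩ {y | Algebra.trace ℚ_[2] (PacketAlgebra 2 k) y = 0}) ∧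
      packetHull 2 k (M ∪ c • (logPacket 2 k : Set (PacketAlgebra 2 k)) ∩ {y | Algebra.trace ℚ_[2] (PacketAlgebra 2 k) y = 0}) ≠
        packetHull 2 k (c • (logPacket 2 k : Set (PacketAlgebra 2 k))) := by
  obtain ⟨-, hπB, hπn⟩ := norm_psi_le_of_mem_smul_logPacket k L ψ hι he hf hϖ b₀ c (x := 0)
    (by rw [← smul_zero c]; exact Set.smul_mem_smul_set (logPacket 2 k).zero_mem) j
  have hsub := packetHull_union_subset_preimage_polydisc_of_deep k L ψ hι he hf hϖ b₀ c hdeep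
  have hnot : c • purePacket 2 k (fun b => (ϖ b : k b) ^ 3) ∉
      packetHull 2 k (M ∪ c • (logPacket 2 k : Set (PacketAlgebra 2 k)) ∩ {y | Algebra.trace ℚ_[2] (PacketAlgebra 2 k) y = 0}) := by
    intro hmem
    have h := (mem_polydisc L).mp (hsub hmem) j
    rw [hπn] at h
    exact absurd h (not_le.mpr (norm_mul_pow_succ_lt k hϖ b₀ hc))
  exact ⟨hnot, fun hEq => hnot (hEq ▸ subset_packetHull 2 k _ hπB)⟩

/-- **THE DISPLAYED EQUIVALENCE (packet level).**  At an all-`ℚ₂(√−1)` packet, for `c ≠ 0`, a region `M ⊆ c·log₂(R_I^×)` and ANY set `S` with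
`M ⊆ S ⊆ M + (c·log₂(R_I^×) ∩ Ker Tr_V)` (e.g. the orbit span of `M` under print's factorwise (Ind1)⊔(Ind2), `Thm311RealInd1StripPacketCeiling`):
`packetHull(S) = packetHull(c·log₂(R_I^×))` **iff `M` ITSELF reaches the container's top polyshell in every component**
(`‖c‖·ρ^{3n} ≤ hullRadius(ψ(M))_j` for all `j`).  The packet twin of `Thm311RealInd1StripHullDyadic.coe_span_add_inter_ker_eq_coe_span_smul_logUnits_iff`;
no Jannsen–Wingberg / Diekert–Nishio input. [cite: Mochizuki2012, IUTchIII Rmk. 3.9.5 (i) p. 127; Thm. 3.11 (i) p. 154; Cor. 3.12 Step (xi) p. 183]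
[cite: DupuyHilado2025, §4.9, §4.12] [claim: Mochizuki2012, status: disputed] -/
theorem packetHull_eq_packetHull_smul_logPacket_iff (b₀ : I) {c : ℚ_[2]} (hc : c ≠ 0) {M S : Set (PacketAlgebra 2 k)}
    (hM : M ⊆ c • (logPacket 2 k : Set (PacketAlgebra 2 k))) (hMS : M ⊆ S)
    (hS : S ⊆ M + c • (logPacket 2 k : Set (PacketAlgebra 2 k)) ∩ {y | Algebra.trace ℚ_[2] (PacketAlgebra 2 k) y = 0}) :
    packetHull 2 k S = packetHull 2 k (c • (logPacket 2 k : Set (PacketAlgebra 2 k))) ↔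
      ∀ j, ‖c‖ * ‖(ϖ b₀ : k b₀)‖ ^ (3 * Fintype.card I) ≤ hullRadius L (ψ '' M) j := by
  haveI : Nonempty I := ⟨b₀⟩
  set B : Set (PacketAlgebra 2 k) := c • (logPacket 2 k : Set (PacketAlgebra 2 k)) with hB
  set A : Set (PacketAlgebra 2 k) := B ∩ {y | Algebra.trace ℚ_[2] (PacketAlgebra 2 k) y = 0} with hA
  have hBbdd : IsBounded (ψ '' B) := isBounded_image_smul_logPacket k L ψ hι he hf hϖ b₀ c
  -- `M + A ⊆ B`
  have hMAB : M + A ⊆ B := by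
    rintro _ ⟨m, hm, a, ⟨ha, -⟩, rfl⟩
    obtain ⟨m', hm', rfl⟩ := Set.mem_smul_set.mp (hM hm)
    obtain ⟨a', ha', rfl⟩ := Set.mem_smul_set.mp ha
    show c • m' + c • a' ∈ B
    rw [← smul_add]; exact Set.smul_mem_smul_set ((logPacket 2 k).add_mem hm' ha')
  have hSB : S ⊆ B := hS.trans hMAB
  have hMbdd : IsBounded (ψ '' M) := hBbdd.subset (Set.image_mono hM)
  have hSbdd : IsBounded (ψ '' S) := hBbdd.subset (Set.image_mono hSB)
  -- radii of `B` are `top`, radii of `M` are `≤ top`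
  have hradB : ∀ j, hullRadius L (ψ '' B) j = ‖c‖ * ‖(ϖ b₀ : k b₀)‖ ^ (3 * Fintype.card I) := fun j => by
    obtain ⟨-, hπB, hπn⟩ := norm_psi_le_of_mem_smul_logPacket k L ψ hι he hf hϖ b₀ c (x := 0)
      (by rw [← smul_zero c]; exact Set.smul_mem_smul_set (logPacket 2 k).zero_mem) j
    refine le_antisymm (hullRadius_le_of_nonneg L (by positivity) ?_) ?_
    · rintro _ ⟨x, hx, rfl⟩; exact (norm_psi_le_of_mem_smul_logPacket k L ψ hι he hf hϖ b₀ c hx j).1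
    · rw [← hπn]; exact norm_apply_le_hullRadius L hBbdd ⟨_, hπB, rfl⟩ j
  have hradM : ∀ j, hullRadius L (ψ '' M) j ≤ ‖c‖ * ‖(ϖ b₀ : k b₀)‖ ^ (3 * Fintype.card I) := fun j =>
    (hullRadius_mono L hBbdd (Set.image_mono hM) j).trans (hradB j).le
  constructor
  · intro hEq j
    -- `c·π ∈ packetHull S ⊆ ψ⁻¹ polydisc(radii of M + A)`, and `radius_j(M + A) ≤ max (radius_j M) (‖c‖ρ^{3n+1})`
    obtain ⟨-, hπB, hπn⟩ := norm_psi_le_of_mem_smul_logPacket k L ψ hι he hf hϖ b₀ c (x := 0)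
      (by rw [← smul_zero c]; exact Set.smul_mem_smul_set (logPacket 2 k).zero_mem) j
    have hMAbdd : IsBounded (ψ '' (M + A)) := hBbdd.subset (Set.image_mono hMAB)
    have hmem : c • purePacket 2 k (fun b => (ϖ b : k b) ^ 3) ∈ packetHull 2 k (M + A) :=
      packetHull_mono 2 k hS (by rw [hEq]; exact subset_packetHull 2 k B hπB)
    rw [packetHull_eq_preimage_holomorphicHull 2 k L ψ hMAbdd, Set.mem_preimage, holomorphicHull_of_isBounded L hMAbdd,
      mem_polydisc] at hmem
    have h1 := hmem j
    rw [hπn] at h1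
    have hrad : hullRadius L (ψ '' (M + A)) j ≤ max (hullRadius L (ψ '' M) j) (‖c‖ * ‖(ϖ b₀ : k b₀)‖ ^ (3 * Fintype.card I + 1)) := by
      refine hullRadius_le_of_nonneg L (le_max_of_le_right (by positivity)) ?_
      rintro _ ⟨_, ⟨m, hm, a, ha, rfl⟩, rfl⟩
      rw [map_add, Pi.add_apply]
      exact (IsUltrametricDist.norm_add_le_max _ _).trans (max_le_max (norm_apply_le_hullRadius L hMbdd ⟨m, hm, rfl⟩ j)
        (norm_psi_le_of_mem_smul_logPacket_inter_ker k L ψ hι he hf hϖ b₀ c ha j))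
    rcases le_max_iff.mp (h1.trans hrad) with h2 | h2
    · exact h2
    · exact absurd h2 (not_le.mpr (norm_mul_pow_succ_lt k hϖ b₀ hc))
  · intro htopM
    have hradM' : ∀ j, hullRadius L (ψ '' M) j = ‖c‖ * ‖(ϖ b₀ : k b₀)‖ ^ (3 * Fintype.card I) :=
      fun j => le_antisymm (hradM j) (htopM j)
    have hHM : packetHull 2 k M = packetHull 2 k B := by
      rw [packetHull_eq_preimage_holomorphicHull 2 k L ψ hMbdd, packetHull_eq_preimage_holomorphicHull 2 k L ψ hBbdd,
        holomorphicHull_of_isBounded L hMbdd, holomorphicHull_of_isBounded L hBbdd]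
      congr 2; funext j; rw [hradM', hradB]
    apply Set.Subset.antisymm
    · rw [← packetHull_packetHull 2 k B]; exact packetHull_mono 2 k (hSB.trans (subset_packetHull 2 k B))
    · rw [← hHM]; exact packetHull_mono 2 k hMS

end Abstract

/-! ## §3 Print's factorwise (Ind1)⊔(Ind2) at a genuine all-`ℚ₂(√−1)` packet of places -/

section Genuine

open NumberField IsDedekindDomain Literature.NumberTheory.NumberFields
open Literature.NumberTheory.GaloisRepresentations Literature.AnabelianGeometry.AbsoluteAnabelian Literature.IUT.HodgeArakelov
open Literature.IUT.HodgeArakelov.AbsTopMonoids Literature.IUT.LogThetaLattice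

variable {K : Type} [Field K] [NumberField K]
variable {I : Type} [Fintype I] [DecidableEq I] (w : I → HeightOneSpectrum (𝓞 K)) (hw : ∀ b, ((2 : ℕ) : 𝓞 K) ∈ (w b).asIdeal)
variable {J : Type} [Fintype J] (L : J → Type) [∀ j, NontriviallyNormedField (L j)] [∀ j, NormedAlgebra ℚ_[2] (L j)]
  [∀ j, IsUltrametricDist (L j)] [∀ j, ProperSpace (L j)]
variable (ψ : PacketAlgebra 2 (fun b => RescaledCompletion K 2 (w b) (hw b)) ≃ₐ[ℚ_[2]] (Π j, L j))
variable {ι : Π b, RescaledCompletion K 2 (w b) (hw b)} (hι : ∀ b, ι b ^ 2 = -1)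
  (he : ∀ b, absRamificationIdx 2 (RescaledCompletion K 2 (w b) (hw b)) = 2)
  (hf : ∀ b, residueDegree 2 (RescaledCompletion K 2 (w b) (hw b)) = 1)
  {ϖ : Π b, (RescaledCompletion K 2 (w b) (hw b))ˣ} (hϖ : ∀ b, IsUniformizer (ϖ b))

include hι he hf hϖ

omit [Fintype J] [∀ j, ProperSpace (L j)] in
/-- **PRINT's FACTORWISE (Ind1)⊔(Ind2) NEVER LIFTS A DEEP PACKET REGION INTO THE CONTAINER's TOP POLYSHELL** (genuine all-`ℚ₂(√−1)` packet;
UNCONDITIONAL).  On `X = ⊗_{ℚ₂, b} K_{w_b}` with every `K_{w_b} ∋ √−1` of shape `(e, f) = (2, 1)`, let `g` be `ℚ₂`-linear acting on pure tensors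
factorwise through elements `γ_b` of the groups generated by print's (Ind1) strip part and (Ind2) at `w_b` (R20 file 2), `M ⊆ c·log₂(R_I^×)` a
`ℤ₂`-stable region all of whose elements have all `ψ`-components of norm `≤ ‖c‖·ρ^{3n+1}` (deep).  Then for every `x ∈ M` and every component `j`:
`‖ψ(g x)_j‖ ≤ ‖c‖·ρ^{3n+1}` — and `< ‖c‖·ρ^{3n} = ‖ψ(c·⊗_b ϖ_b³)_j‖` if `c ≠ 0` (`norm_mul_pow_succ_lt`): the orbit stays in the ceiling
`M + (c·log₂(R_I^×) ∩ Ker Tr_X)` (`image_subset_add_inter_ker_of_factorwise_printInd1Ind2`, `p`-generic), whose components are one shell down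
(§1). [cite: Mochizuki2012, IUTchIII Thm. 3.11 (i) (Ind1)(Ind2) p. 154; Cor. 3.12 Step (xi) p. 183] [cite: DupuyHilado2025, §4.9, §4.12]
[cite: HoshiNishio2022OuterAutMLF, Lemma 2.3 (ii) p. 7] [claim: Mochizuki2012, status: disputed] -/
theorem norm_psi_apply_le_of_factorwise_printInd1Ind2_of_deep (b₀ : I)
    (γ : ∀ b, Carrier (.inr (w b) : Thm311.Real.Place K) ≃ₗ[ℚ] Carrier (.inr (w b) : Thm311.Real.Place K))
    (hγ : ∀ b, γ b ∈ Subgroup.closure (ind1Strip (analyticLogv K) (w b) ∪ ismIsm (analyticLogv K) (w b)))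
    (g : PacketAlgebra 2 (fun b => RescaledCompletion K 2 (w b) (hw b)) ≃ₗ[ℚ_[2]]
      PacketAlgebra 2 (fun b => RescaledCompletion K 2 (w b) (hw b)))
    (hg : ∀ x : Π b, RescaledCompletion K 2 (w b) (hw b),
      g (PiTensorProduct.tprod ℚ_[2] x) =
        PiTensorProduct.tprod ℚ_[2] (fun b =>
          RescaledCompletion.of K 2 (w b) (hw b) (γ b ((RescaledCompletion.of K 2 (w b) (hw b)).symm (x b)))))
    (c : ℚ_[2]) (M : AddSubgroup (PacketAlgebra 2 (fun b => RescaledCompletion K 2 (w b) (hw b))))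
    (hMs : ∀ a : ℚ_[2], ‖a‖ ≤ 1 → ∀ z ∈ M, a • z ∈ M)
    (hM : (M : Set (PacketAlgebra 2 (fun b => RescaledCompletion K 2 (w b) (hw b)))) ⊆
      c • (logPacket 2 (fun b => RescaledCompletion K 2 (w b) (hw b)) : Set _))
    (hdeep : ∀ x ∈ M, ∀ j, ‖ψ x j‖ ≤ ‖c‖ * ‖(ϖ b₀ : RescaledCompletion K 2 (w b₀) (hw b₀))‖ ^ (3 * Fintype.card I + 1))
    {x : PacketAlgebra 2 (fun b => RescaledCompletion K 2 (w b) (hw b))} (hx : x ∈ M) (j : J) :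
    ‖ψ (g x) j‖ ≤ ‖c‖ * ‖(ϖ b₀ : RescaledCompletion K 2 (w b₀) (hw b₀))‖ ^ (3 * Fintype.card I + 1) := by
  have hsub := image_subset_add_inter_ker_of_factorwise_printInd1Ind2 2 w hw γ hγ g hg c M hMs hM
  obtain ⟨m, hm, y, hy, hmy⟩ := hsub ⟨x, hx, rfl⟩
  rw [← hmy, map_add, Pi.add_apply]
  exact (IsUltrametricDist.norm_add_le_max _ _).trans (max_le (hdeep m hm j)
    (norm_psi_le_of_mem_smul_logPacket_inter_ker (fun b => RescaledCompletion K 2 (w b) (hw b)) L ψ hι he hf hϖ b₀ c hy j))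

omit [Fintype J] [∀ j, ProperSpace (L j)] in
/-- **… hence the whole print-(Ind1)⊔(Ind2) orbit of a deep region has hull inside the sub-polydisc `‖c‖·ρ^{3n+1}`, missing the container's top**
(`c ≠ 0`): for every factorwise print element `g` as above and `x ∈ M`, `g x` is deep again, so the `(R_I)^∼`-hull of `M ∪ g(M) ∪ (ceiling part)`
never contains `c·⊗_b ϖ_b³` (§2 `smul_purePacket_not_mem_packetHull_union_of_deep` applies to `M ∪ g(M)`). [cite: Mochizuki2012, IUTchIII Thm. 3.11
(i) p. 154; Cor. 3.12 Step (xi) p. 183] [cite: DupuyHilado2025, §4.9, §4.12] [claim: Mochizuki2012, status: disputed] -/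
theorem image_union_deep_of_factorwise_printInd1Ind2_of_deep (b₀ : I)
    (γ : ∀ b, Carrier (.inr (w b) : Thm311.Real.Place K) ≃ₗ[ℚ] Carrier (.inr (w b) : Thm311.Real.Place K))
    (hγ : ∀ b, γ b ∈ Subgroup.closure (ind1Strip (analyticLogv K) (w b) ∪ ismIsm (analyticLogv K) (w b)))
    (g : PacketAlgebra 2 (fun b => RescaledCompletion K 2 (w b) (hw b)) ≃ₗ[ℚ_[2]]
      PacketAlgebra 2 (fun b => RescaledCompletion K 2 (w b) (hw b)))
    (hg : ∀ x : Π b, RescaledCompletion K 2 (w b) (hw b),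
      g (PiTensorProduct.tprod ℚ_[2] x) =
        PiTensorProduct.tprod ℚ_[2] (fun b =>
          RescaledCompletion.of K 2 (w b) (hw b) (γ b ((RescaledCompletion.of K 2 (w b) (hw b)).symm (x b)))))
    (c : ℚ_[2]) (M : AddSubgroup (PacketAlgebra 2 (fun b => RescaledCompletion K 2 (w b) (hw b))))
    (hMs : ∀ a : ℚ_[2], ‖a‖ ≤ 1 → ∀ z ∈ M, a • z ∈ M)
    (hM : (M : Set (PacketAlgebra 2 (fun b => RescaledCompletion K 2 (w b) (hw b)))) ⊆
      c • (logPacket 2 (fun b => RescaledCompletion K 2 (w b) (hw b)) : Set _))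
    (hdeep : ∀ x ∈ M, ∀ j, ‖ψ x j‖ ≤ ‖c‖ * ‖(ϖ b₀ : RescaledCompletion K 2 (w b₀) (hw b₀))‖ ^ (3 * Fintype.card I + 1)) :
    ∀ x ∈ (M : Set _) ∪ g '' (M : Set _), ∀ j,
      ‖ψ x j‖ ≤ ‖c‖ * ‖(ϖ b₀ : RescaledCompletion K 2 (w b₀) (hw b₀))‖ ^ (3 * Fintype.card I + 1) := by
  rintro x (hx | ⟨x', hx', rfl⟩) j
  · exact hdeep x hx j
  · exact norm_psi_apply_le_of_factorwise_printInd1Ind2_of_deep w hw L ψ hι he hf hϖ b₀ γ hγ g hg c M hMs hM hdeep hx' j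

end Genuine

end Summit.ABC.IUTFork.Thm311.Real.PacketHull

end
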